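import Summits.ValiantsHypothesis.ValiantsHypothesis.Theses.HartogsRankTwo
import Literature.Computability.AlgebraicComplexity.AndrewsForbes2022Lemma210CharZero

/-!
# Route HartogsRankTwo — item `KernelIsMinors` (stmt-ValiantsHypothesis-10337), closed

`KernelIsMinors`: a polynomial `P ∈ ℂ[X]` (`X` the generic `n × n` matrix) vanishes on all matrices
of rank `≤ 2`, presented as `U Vᵀ` with `U, V ∈ ℂ^{n × 2}`, iff it lies in the ideal generated by
the `3 × 3` minors of `X` — the Second Fundamental Theorem of invariant theory for `GL_2` in point
form (the determinantal ideal `I_3` is the full vanishing ideal of the rank-`≤ 2` locus).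

Proof: the tree has the kernel form of the SFT in characteristic `0`,
`ker_genericProductHom_eq_determinantalIdeal_of_charZero` (`ker (X ↦ Y Z) = I_{t+1}`,
`AndrewsForbes2022Lemma210CharZero.lean`, via the Arbarello–Cornalba–Griffiths–Harris straightening
law), whose `determinantalIdeal (Fin n) (Fin n) ℂ 3` is literally the item's span of `3 × 3` minors;
over the infinite field `ℂ`, `P(Y Z) = 0` as a polynomial in `(Y, Z)` iff it vanishes at every
point (`MvPolynomial.funext`, `eval_genericProductHom`).

* `kernelIsMinors_proof : KernelIsMinors` — the item, verbatim.

Honest framing: a dictionary lemma of the (settled) route HartogsRankTwo; nothing here bears on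
VP ≠ VNP.

## References
* C. De Concini, D. Eisenbud, C. Procesi, *Young diagrams and determinantal varieties*,
  Invent. Math. 56 (1980). [DeConciniEisenbudProcesi1980]
* R. Goodman, N. Wallach, *Symmetry, Representations, and Invariants*, GTM 255, Thm. 12.2.12.
  [GoodmanWallachGTM255]
-/

set_option linter.dupNamespace false

noncomputable section

namespace Summit.ValiantsHypothesis.ValiantsHypothesis.Theorems.HartogsRankTwo

open MvPolynomial
open Literature.Computability.AlgebraicComplexity

/-- **Item `KernelIsMinors` (stmt-ValiantsHypothesis-10337).** A polynomial vanishes on all `U Vᵀ`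
(`U, V ∈ ℂ^{n×2}`) iff it lies in the ideal of the `3 × 3` minors of the generic `n × n` matrix: the
Second Fundamental Theorem for `GL_2` in point form, from the tree's kernel form in characteristic
`0` and `MvPolynomial.funext` over the infinite field `ℂ`.
[cite: GoodmanWallachGTM255, Thm. 12.2.12] -/
theorem kernelIsMinors_proof : Theses.HartogsRankTwo.KernelIsMinors := by
  intro n P
  have hI : Ideal.span (Set.range fun rc : (Fin 3 → Fin n) × (Fin 3 → Fin n) =>
      ((Matrix.mvPolynomialX (Fin n) (Fin n) ℂ).submatrix rc.1 rc.2).det) =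
      determinantalIdeal (Fin n) (Fin n) ℂ 3 := rfl
  rw [hI, ← ker_genericProductHom_eq_determinantalIdeal_of_charZero ℂ n n 2, RingHom.mem_ker]
  constructor
  · intro h
    apply MvPolynomial.funext
    intro w
    rw [map_zero, eval_genericProductHom]
    simpa only [Matrix.mul_apply, Matrix.of_apply] using
      h (fun i k => w (Sum.inl (i, k))) (fun j k => w (Sum.inr (k, j)))
  · intro h U V
    have hev := congrArg (MvPolynomial.eval (Sum.elim (fun ik : Fin n × Fin 2 => U ik.1 ik.2)
      (fun kj : Fin 2 × Fin n => V kj.2 kj.1))) h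
    rw [map_zero, eval_genericProductHom] at hev
    simpa only [Matrix.mul_apply, Matrix.of_apply, Sum.elim_inl, Sum.elim_inr] using hev

end Summit.ValiantsHypothesis.ValiantsHypothesis.Theorems.HartogsRankTwo
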